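import Summits.QuantumFields.GaugeBoot.LoopEquation
import Summits.QuantumFields.GaugeBoot.WordLoop
import Literature.LinearAlgebra.Matrix.UnitaryGroupMaximalTorus
import Mathlib.Analysis.SpecialFunctions.Complex.Arg
import HarnessLib

/-!
# The `SU(3)` kinematical inequalities, pointwise and among torus expectations (cell `gauge-boot`, seat lean2)

Honest framing (cell rule): certified bounds on lattice expectations at stated coupling, gauge group, dimension and
torus size; NOT a mass gap, NOT a continuum limit, NOT a string tension, NOT large `N`; not summit-bearing
(`FixedCouplingUltralocality`, `PerturbativeInvisibility`).  This file enters NO bound, NO certificate and NO index row.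

Every `SU(3)` loop-equation problem of this cell (`certs/SU3-D*/rung0/*.problem1.json`, the kz-L2 `SU(3)` files of
num3 / eng2) carries, besides its equality rows, three kinds of β-independent INEQUALITY rows among its variables
`w(C) = ⟨(1/3) Re tr hol C⟩_β` and `d(A, B) = Re ⟨tr hol A · tr hol B⟩_β / 9` (`ineq_rows[].src`):

* `Re tr V/3 >= -1/2 on SU(3)` (one row per single-loop variable),
* `|W_P|^2 <= 1` (`d(P, P⁻¹) ≤ 1`),
* `deltoid chord on SU(3): 2<(Im W_P)^2> + u <= 1  [(Im w)^2 <= (1 - Re w)/2 pointwise, w = tr/3]`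
  (`d(P⁻¹, P) − d(P, P) + w(P) ≤ 1`),

plus the box `|y_v| ≤ 1` of every variable (`bounds.default_abs = 1`).  They are consequences of two pointwise facts
about `t = tr U`, `U ∈ SU(3)`: the eigenvalues are `z₁, z₂, z₃ = conj(z₁ z₂)` on the unit circle, so `t` ranges over
the closed 3-cusped deltoid, and on it `Re t ≥ -3/2` and `(Im t)² ≤ (3/2)(3 − Re t)` (the parabola through the three
cusps `t = 3, 3e^{±2πi/3}`, where equality holds).  Neither was in the tree.  This file proves them and integrates:

* §1 the two inequalities for `t = z₁ + z₂ + conj(z₁ z₂)`, `‖z₁‖ = ‖z₂‖ = 1`: `deltoid_re_ge` (from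
  `2 Re t + 3 = |1 + conj z₁ + z₂|²`) and `deltoid_im_sq_le` (half angles `z₁ = e^{i(u+v)}`, `z₂ = e^{i(u−v)}` give
  `Re t = 2 cos u cos v + 2 cos²u − 1`, `Im t = 2 sin u (cos v − cos u)`, `re_im_exp_sum_half_angle`, and the
  certificate `deltoid_chord_certificate`:
  `6 − 3Cc − 3C² − 4(1−C²)(c−C)² = ((1+c)/2)(1−C)(2C+1)²(2−C) + ((1−c)/2)(1+C)(2C−1)²(2+C) + 4(1−C²)(1−c²) ≥ 0`
  on `[−1, 1]²`);
* §2 the eigenvalue form of trace and determinant of a unitary matrix (`exists_trace_eq_sum_unit_of_mem_unitaryGroup`,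
  from the tree's `exists_unitaryGroup_conj_eq_diagonal`, Bröcker–tom Dieck IV (3.1)), its `SU(3)` case
  `exists_trace_eq_of_mem_specialUnitaryGroup_three`, and the pointwise rows `su3_re_trace_ge`, `su3_im_trace_sq_le`,
  `su3_deltoid_chord` (`2 (Im t/3)² + Re t/3 ≤ 1`), `norm_trace_le_card_of_mem_unitaryGroup` (`|tr U| ≤ n`);
* §3 the rows among TORUS EXPECTATIONS for lattice `SU(N)` / `SU(3)` Yang–Mills (fundamental representation, tree
  coupling `β`) on `(ℤ/L)^d`, every real `β`, every `d`, every `L ≥ 1`, in the variables of `SU3KinematicalRows`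
  (no new definition): the box `|Re E[tr hol A · tr hol B]| ≤ N²` (`abs_re_integral_trace_mul_trace_le`),
  `w(X) ≥ −1/2` (`su3_wilsonExpectation_wordLoop_ge`, any word), `d(X⁻¹, X) ≤ 1` (`su3_modulus_sq_row`) and the chord
  row `d(X⁻¹, X) − d(X, X) + w(X) ≤ 1` (`su3_deltoid_chord_row`, closed `X`).

These are the pointwise facts an `SU(3)` certificate half in Lean would have to discharge for its inequality
multipliers; instance bookkeeping (which loops, labels, orbits) stays the generators'.  Everything is `[folklore]`
(the deltoid `{tr U : U ∈ SU(3)}`: e.g. Kazakov–Zheng arXiv:2404.16925 §2.3, Guo–Li–Yang–Zhu arXiv:2502.14421 App. A).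
-/

noncomputable section

open MeasureTheory
open scoped Matrix ComplexConjugate
open Literature.MathematicalPhysics.QuantumFieldTheory
open Literature.MathematicalPhysics.QuantumLattice
open Literature.LinearAlgebra.Matrix (exists_unitaryGroup_conj_eq_diagonal norm_eq_one_of_diagonal_mem_unitaryGroup)

namespace Summit.QuantumFields.GaugeBoot

/-! ## §1 The deltoid inequalities for `z₁ + z₂ + conj (z₁ z₂)` on the torus -/

section Deltoid

/-- On the unit circle `re² + im² = 1`. [folklore] -/
theorem re_sq_add_im_sq_of_norm_eq_one {z : ℂ} (hz : ‖z‖ = 1) : z.re * z.re + z.im * z.im = 1 := by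
  rw [← Complex.normSq_apply, Complex.normSq_eq_norm_sq, hz, one_pow]

/-- **`Re t ≥ -3/2` on the deltoid**: for `z₁, z₂` on the unit circle, `Re (z₁ + z₂ + conj (z₁ z₂)) ≥ -3/2`
(indeed `2 Re t + 3 = |1 + conj z₁ + z₂|²`; equality iff `z₁ = z₂ = e^{∓2πi/3}`). [folklore] -/
theorem deltoid_re_ge (z₁ z₂ : ℂ) (h₁ : ‖z₁‖ = 1) (h₂ : ‖z₂‖ = 1) :
    -(3 / 2 : ℝ) ≤ (z₁ + z₂ + conj (z₁ * z₂)).re := by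
  have e₁ := re_sq_add_im_sq_of_norm_eq_one h₁
  have e₂ := re_sq_add_im_sq_of_norm_eq_one h₂
  simp only [Complex.add_re, Complex.conj_re, Complex.mul_re]
  nlinarith [sq_nonneg (1 + z₁.re + z₂.re), sq_nonneg (z₂.im - z₁.im)]

/-- **Half-angle form**: with `z₁ = e^{i(u+v)}`, `z₂ = e^{i(u-v)}` and
`t = z₁ + z₂ + conj (z₁ z₂) = z₁ + z₂ + e^{-2iu}`: `Re t = 2 cos u cos v + 2 cos² u − 1` and
`Im t = 2 sin u (cos v − cos u)`. [folklore] -/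
theorem re_im_exp_sum_half_angle (u v : ℝ) :
    (Complex.exp (↑(u + v) * Complex.I) + Complex.exp (↑(u - v) * Complex.I) +
          conj (Complex.exp (↑(u + v) * Complex.I) * Complex.exp (↑(u - v) * Complex.I))).re =
        2 * Real.cos u * Real.cos v + 2 * Real.cos u ^ 2 - 1 ∧
      (Complex.exp (↑(u + v) * Complex.I) + Complex.exp (↑(u - v) * Complex.I) +
          conj (Complex.exp (↑(u + v) * Complex.I) * Complex.exp (↑(u - v) * Complex.I))).im =
        2 * Real.sin u * (Real.cos v - Real.cos u) := by
  have hu := Real.sin_sq_add_cos_sq u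
  have hv := Real.sin_sq_add_cos_sq v
  constructor
  · simp only [Complex.add_re, Complex.conj_re, Complex.mul_re, Complex.exp_ofReal_mul_I_re,
      Complex.exp_ofReal_mul_I_im, Real.cos_add, Real.cos_sub, Real.sin_add, Real.sin_sub]
    linear_combination (Real.cos u ^ 2 - Real.sin u ^ 2) * hv - hu
  · simp only [Complex.add_im, Complex.conj_im, Complex.mul_im, Complex.exp_ofReal_mul_I_re,
      Complex.exp_ofReal_mul_I_im, Real.cos_add, Real.cos_sub, Real.sin_add, Real.sin_sub]
    linear_combination (-2 * Real.cos u * Real.sin u) * hv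

/-- **The chord certificate** on the square `[-1, 1]²` (`C = cos u`, `c = cos v`):
`6 − 3Cc − 3C² − 4(1 − C²)(c − C)²`
`= ((1+c)/2)(1−C)(2C+1)²(2−C) + ((1−c)/2)(1+C)(2C−1)²(2+C) + 4(1−C²)(1−c²) ≥ 0`, each summand being non-negative;
equality exactly at `(C, c) ∈ {(1, 1), (−1, −1), (−1/2, 1), (1/2, −1)}`, the half-angle parameters of the three cusps.
[folklore] -/
theorem deltoid_chord_certificate (C c : ℝ) (hC1 : C ≤ 1) (hC2 : -1 ≤ C) (hc1 : c ≤ 1) (hc2 : -1 ≤ c) :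
    4 * (1 - C ^ 2) * (c - C) ^ 2 ≤ 6 - 3 * C * c - 3 * C ^ 2 := by
  have t1 : 0 ≤ (1 + c) / 2 * (1 - C) * (2 * C + 1) ^ 2 * (2 - C) :=
    mul_nonneg (mul_nonneg (mul_nonneg (by linarith) (by linarith)) (sq_nonneg _)) (by linarith)
  have t2 : 0 ≤ (1 - c) / 2 * (1 + C) * (2 * C - 1) ^ 2 * (2 + C) :=
    mul_nonneg (mul_nonneg (mul_nonneg (by linarith) (by linarith)) (sq_nonneg _)) (by linarith)
  have t3 : 0 ≤ 4 * (1 - C ^ 2) * (1 - c ^ 2) :=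
    mul_nonneg (mul_nonneg (by norm_num) (by nlinarith)) (by nlinarith)
  nlinarith [t1, t2, t3]

/-- **The deltoid chord inequality**: for `z₁, z₂` on the unit circle and `t = z₁ + z₂ + conj (z₁ z₂)`,
`(Im t)² ≤ (3/2)(3 − Re t)` — the parabola through the three cusps `3, 3e^{±2πi/3}` of the deltoid
`{e^{ia} + e^{ib} + e^{-i(a+b)}}` encloses it (equality exactly at the cusps). [folklore] -/
theorem deltoid_im_sq_le (z₁ z₂ : ℂ) (h₁ : ‖z₁‖ = 1) (h₂ : ‖z₂‖ = 1) :
    (z₁ + z₂ + conj (z₁ * z₂)).im ^ 2 ≤ 3 / 2 * (3 - (z₁ + z₂ + conj (z₁ * z₂)).re) := by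
  obtain ⟨a, rfl⟩ := (Complex.norm_eq_one_iff z₁).mp h₁
  obtain ⟨b, rfl⟩ := (Complex.norm_eq_one_iff z₂).mp h₂
  obtain ⟨u, v, rfl, rfl⟩ : ∃ u v : ℝ, a = u + v ∧ b = u - v := ⟨(a + b) / 2, (a - b) / 2, by ring, by ring⟩
  obtain ⟨hR, hI⟩ := re_im_exp_sum_half_angle u v
  rw [hR, hI]
  have hS : Real.sin u ^ 2 = 1 - Real.cos u ^ 2 := by linear_combination Real.sin_sq_add_cos_sq u
  have hL : (2 * Real.sin u * (Real.cos v - Real.cos u)) ^ 2 =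
      4 * (1 - Real.cos u ^ 2) * (Real.cos v - Real.cos u) ^ 2 := by
    linear_combination (4 * (Real.cos v - Real.cos u) ^ 2) * hS
  rw [hL]
  have h := deltoid_chord_certificate (Real.cos u) (Real.cos v) (Real.cos_le_one u) (Real.neg_one_le_cos u)
    (Real.cos_le_one v) (Real.neg_one_le_cos v)
  linarith

end Deltoid

/-! ## §2 Eigenvalue form of the trace; the pointwise `SU(3)` inequalities -/

section Eigen

variable {n : Type*} [DecidableEq n] [Fintype n]

/-- **Eigenvalue form of trace and determinant of a unitary matrix**: `tr U = ∑ zᵢ`, `det U = ∏ zᵢ` with all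
`|zᵢ| = 1` (`U = V diag(z) V⋆`, tree `exists_unitaryGroup_conj_eq_diagonal`, Bröcker–tom Dieck IV (3.1)).
[folklore] -/
theorem exists_trace_eq_sum_unit_of_mem_unitaryGroup {U : Matrix n n ℂ} (hU : U ∈ Matrix.unitaryGroup n ℂ) :
    ∃ z : n → ℂ, (∀ i, ‖z i‖ = 1) ∧ U.trace = ∑ i, z i ∧ U.det = ∏ i, z i := by
  obtain ⟨V, hV, z, hz⟩ := exists_unitaryGroup_conj_eq_diagonal U hU
  have hVV : V * star V = 1 := Matrix.mem_unitaryGroup_iff.mp hV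
  have hVV' : star V * V = 1 := Matrix.mem_unitaryGroup_iff'.mp hV
  have hVs : star V ∈ Matrix.unitaryGroup n ℂ := Matrix.mem_unitaryGroup_iff.mpr (by rw [star_star]; exact hVV')
  have hD : Matrix.diagonal z ∈ Matrix.unitaryGroup n ℂ := by
    rw [← hz]; exact mul_mem (mul_mem hVs hU) hV
  refine ⟨z, norm_eq_one_of_diagonal_mem_unitaryGroup hD, ?_, ?_⟩
  · rw [← Matrix.trace_diagonal, ← hz, Matrix.trace_mul_comm, ← Matrix.mul_assoc, hVV, Matrix.one_mul]
  · have h := congr_arg Matrix.det hz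
    rw [Matrix.det_mul, Matrix.det_mul, Matrix.det_diagonal] at h
    have h1 : (star V).det * V.det = 1 := by rw [← Matrix.det_mul, hVV', Matrix.det_one]
    rw [← h]
    linear_combination -(U.det) * h1

/-- **`SU(3)` eigenvalues**: for `U ∈ SU(3)`, `tr U = z₁ + z₂ + conj (z₁ z₂)` with `z₁, z₂` on the unit circle
(the third eigenvalue is `(z₁ z₂)⁻¹ = conj (z₁ z₂)` by `det U = 1`). [folklore] -/
theorem exists_trace_eq_of_mem_specialUnitaryGroup_three {U : Matrix (Fin 3) (Fin 3) ℂ}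
    (hU : U ∈ Matrix.specialUnitaryGroup (Fin 3) ℂ) :
    ∃ z₁ z₂ : ℂ, ‖z₁‖ = 1 ∧ ‖z₂‖ = 1 ∧ U.trace = z₁ + z₂ + conj (z₁ * z₂) := by
  obtain ⟨hUu, hdet⟩ := Matrix.mem_specialUnitaryGroup_iff.mp hU
  obtain ⟨z, hz, htr, hdet'⟩ := exists_trace_eq_sum_unit_of_mem_unitaryGroup hUu
  rw [Fin.sum_univ_three] at htr
  rw [Fin.prod_univ_three, hdet] at hdet'
  refine ⟨z 0, z 1, hz 0, hz 1, ?_⟩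
  have hw : ‖z 0 * z 1‖ = 1 := by rw [norm_mul, hz 0, hz 1, mul_one]
  have hw1 : z 0 * z 1 * conj (z 0 * z 1) = 1 := by
    rw [Complex.mul_conj, Complex.normSq_eq_norm_sq, hw, one_pow, Complex.ofReal_one]
  have hw0 : z 0 * z 1 ≠ 0 := fun h => by
    rw [h, norm_zero] at hw
    exact zero_ne_one hw
  have h2 : z 2 = conj (z 0 * z 1) := mul_left_cancel₀ hw0 (hdet'.symm.trans hw1.symm)
  rw [htr, h2]

/-- **`Re tr U ≥ -3/2` on `SU(3)`** (the row kind `Re tr V/3 >= -1/2 on SU(3)` of the problems of record;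
equality at the centre elements `e^{±2πi/3}·1`). [folklore] -/
theorem su3_re_trace_ge (U : Matrix.specialUnitaryGroup (Fin 3) ℂ) :
    -(3 / 2 : ℝ) ≤ (U : Matrix (Fin 3) (Fin 3) ℂ).trace.re := by
  obtain ⟨z₁, z₂, h₁, h₂, h⟩ := exists_trace_eq_of_mem_specialUnitaryGroup_three U.2
  rw [h]
  exact deltoid_re_ge z₁ z₂ h₁ h₂

/-- **The deltoid chord inequality on `SU(3)`**: `(Im tr U)² ≤ (3/2)(3 − Re tr U)`. [folklore] -/
theorem su3_im_trace_sq_le (U : Matrix.specialUnitaryGroup (Fin 3) ℂ) :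
    (U : Matrix (Fin 3) (Fin 3) ℂ).trace.im ^ 2 ≤ 3 / 2 * (3 - (U : Matrix (Fin 3) (Fin 3) ℂ).trace.re) := by
  obtain ⟨z₁, z₂, h₁, h₂, h⟩ := exists_trace_eq_of_mem_specialUnitaryGroup_three U.2
  rw [h]
  exact deltoid_im_sq_le z₁ z₂ h₁ h₂

/-- The same two facts in the generators' normalisation `w = tr U/3`: `Re w ≥ -1/2`. [folklore] -/
theorem su3_re_trace_div_three_ge (U : Matrix.specialUnitaryGroup (Fin 3) ℂ) :
    -(1 / 2 : ℝ) ≤ (U : Matrix (Fin 3) (Fin 3) ℂ).trace.re / 3 := by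
  have h := su3_re_trace_ge U
  linarith

/-- **`deltoid chord on SU(3)`, pointwise**: `2 (Im w)² + Re w ≤ 1`, i.e. `(Im w)² ≤ (1 − Re w)/2`, `w = tr U/3`
(the bracket of the problems' `src` string). [folklore] -/
theorem su3_deltoid_chord (U : Matrix.specialUnitaryGroup (Fin 3) ℂ) :
    2 * ((U : Matrix (Fin 3) (Fin 3) ℂ).trace.im / 3) ^ 2 + (U : Matrix (Fin 3) (Fin 3) ℂ).trace.re / 3 ≤ 1 := by
  have h := su3_im_trace_sq_le U
  nlinarith [h]

/-- `|tr U| ≤ n` for a unitary `n × n` matrix (entries of modulus `≤ 1`, Mathlib `entry_norm_bound_of_unitary`).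
[folklore] -/
theorem norm_trace_le_card_of_mem_unitaryGroup {M : Matrix n n ℂ} (hM : M ∈ Matrix.unitaryGroup n ℂ) :
    ‖M.trace‖ ≤ Fintype.card n := by
  calc ‖M.trace‖ = ‖∑ i, M i i‖ := rfl
    _ ≤ ∑ i, ‖M i i‖ := norm_sum_le _ _
    _ ≤ ∑ _i : n, (1 : ℝ) := Finset.sum_le_sum fun i _ => entry_norm_bound_of_unitary hM i i
    _ = Fintype.card n := by simp

/-- `|tr ρ(g)| ≤ N` in the fundamental representation of `SU(N)`. [folklore] -/
theorem norm_trace_fundamentalRep_le (N : ℕ) (g : Matrix.specialUnitaryGroup (Fin N) ℂ) :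
    ‖(fundamentalRep (Fin N) g).trace‖ ≤ N := by
  have h := norm_trace_le_card_of_mem_unitaryGroup (Matrix.mem_specialUnitaryGroup_iff.mp g.2).1
  rwa [Fintype.card_fin] at h

end Eigen

/-! ## §3 The inequality rows among torus expectations -/

section Rows

variable (N : ℕ) {d L : ℕ}

/-- **The box for pair variables** (`bounds.default_abs = 1` of the problems of record, general `N`):
`|Re E[tr hol_x(v) · tr hol_y(w)]| ≤ N²` for lattice `SU(N)` Yang–Mills on `(ℤ/L)^d`, every real `β`, every `d`,
every `L ≥ 1`, any words `v`, `w` (so `|d(A, B)| ≤ 1` with `d = Re E[tr·tr]/N²`). [folklore] -/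
theorem abs_re_integral_trace_mul_trace_le [NeZero L] (β : ℝ) (x y : Site d L) (v w : Word d) :
    |(∫ U, (fundamentalRep (Fin N) (wordHolonomy U x v)).trace * (fundamentalRep (Fin N) (wordHolonomy U y w)).trace
        ∂(wilsonMeasure (d := d) (L := L) (fundamentalRep (Fin N)) β)).re| ≤ (N : ℝ) ^ 2 := by
  haveI := isProbabilityMeasure_wilsonMeasure (d := d) (L := L) (fundamentalRep (Fin N))
    (continuous_fundamentalRep (Fin N)) β
  have hb : ∀ U : GaugeConfig d L (Matrix.specialUnitaryGroup (Fin N) ℂ),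
      ‖(fundamentalRep (Fin N) (wordHolonomy U x v)).trace * (fundamentalRep (Fin N) (wordHolonomy U y w)).trace‖ ≤
        (N : ℝ) ^ 2 := fun U => by
    rw [norm_mul, sq]
    exact mul_le_mul (norm_trace_fundamentalRep_le N _) (norm_trace_fundamentalRep_le N _) (norm_nonneg _)
      (Nat.cast_nonneg N)
  have h := norm_integral_le_of_norm_le_const
    (μ := wilsonMeasure (d := d) (L := L) (fundamentalRep (Fin N)) β) (ae_of_all _ hb)
  rw [probReal_univ, mul_one] at h
  exact (Complex.abs_re_le_norm _).trans h

/-- **`Re tr V/3 >= -1/2 on SU(3)` among torus expectations**: for lattice `SU(3)` Yang–Mills on `(ℤ/L)^d`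
(every real `β`, every `d`, every `L ≥ 1`) and ANY word `X` read from `x`,
`w(X) = ⟨wordLoop⟩_β = E[(1/3) Re tr hol X] ≥ -1/2`. [folklore] -/
theorem su3_wilsonExpectation_wordLoop_ge [NeZero L] (β : ℝ) (x : Site d L) (X : Word d) :
    -(1 / 2 : ℝ) ≤ wilsonExpectation (d := d) (L := L) (fundamentalRep (Fin 3)) β
        (wordLoop (fundamentalRep (Fin 3)) x X) := by
  haveI := isProbabilityMeasure_wilsonMeasure (d := d) (L := L) (fundamentalRep (Fin 3))
    (continuous_fundamentalRep (Fin 3)) β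
  have hpt : ∀ U : GaugeConfig d L (Matrix.specialUnitaryGroup (Fin 3) ℂ),
      -(1 / 2 : ℝ) ≤ wordLoop (fundamentalRep (Fin 3)) x X U := fun U => by
    rw [wordLoop_apply, fundamentalRep_apply]
    have h := su3_re_trace_ge (wordHolonomy U x X)
    norm_num at h ⊢
    linarith
  unfold wilsonExpectation
  calc -(1 / 2 : ℝ) = ∫ _U, -(1 / 2 : ℝ) ∂(wilsonMeasure (d := d) (L := L) (fundamentalRep (Fin 3)) β) := by
        rw [integral_const, probReal_univ, one_smul]
    _ ≤ ∫ U, wordLoop (fundamentalRep (Fin 3)) x X U ∂(wilsonMeasure (d := d) (L := L) (fundamentalRep (Fin 3)) β) :=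
        integral_mono (integrable_const _)
          (integrable_wordLoop (fundamentalRep (Fin 3)) (continuous_fundamentalRep (Fin 3)) β x X) hpt

/-- **`|W_P|^2 <= 1` among torus expectations** (`d(X⁻¹, X) ≤ 1`; for a closed word the integrand
`tr hol(X⁻¹) · tr hol X = |tr hol X|²` is `9 |W_X|²`): `Re E[tr hol(X⁻¹) · tr hol X] / 9 ≤ 1` for lattice `SU(3)`
on `(ℤ/L)^d`, every real `β`, `d`, `L ≥ 1`, any word `X` (`X⁻¹ = reverse X`; closedness is not needed for the
bound, which is the pair box `abs_re_integral_trace_mul_trace_le`). [folklore] -/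
theorem su3_modulus_sq_row [NeZero L] (β : ℝ) (x : Site d L) (X : Word d) :
    (∫ U, (fundamentalRep (Fin 3) (wordHolonomy U x (Word.reverse X))).trace *
          (fundamentalRep (Fin 3) (wordHolonomy U x X)).trace
        ∂(wilsonMeasure (d := d) (L := L) (fundamentalRep (Fin 3)) β)).re / 9 ≤ 1 := by
  have h := (le_abs_self _).trans (abs_re_integral_trace_mul_trace_le (d := d) (L := L) 3 β x x (Word.reverse X) X)
  have h9 : ((3 : ℕ) : ℝ) ^ 2 = 9 := by norm_num
  rw [h9] at h
  linarith

/-- **The chord row, pointwise on configurations** (any word `X` from `x`, `t = tr hol X`):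
`Re(conj t · t)/9 − Re(t · t)/9 + Re t/3 = 2 (Im t)²/9 + Re t/3 ≤ 1`. [folklore] -/
theorem su3_deltoid_chord_wordHolonomy (U : GaugeConfig d L (Matrix.specialUnitaryGroup (Fin 3) ℂ))
    (x : Site d L) (X : Word d) :
    (conj (fundamentalRep (Fin 3) (wordHolonomy U x X)).trace *
            (fundamentalRep (Fin 3) (wordHolonomy U x X)).trace).re / 9 -
        ((fundamentalRep (Fin 3) (wordHolonomy U x X)).trace *
            (fundamentalRep (Fin 3) (wordHolonomy U x X)).trace).re / 9 +
        wordLoop (fundamentalRep (Fin 3)) x X U ≤ 1 := by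
  rw [wordLoop_apply, fundamentalRep_apply]
  have h := su3_im_trace_sq_le (wordHolonomy U x X)
  simp only [Complex.mul_re, Complex.conj_re, Complex.conj_im]
  norm_num
  nlinarith [h]

/-- **`deltoid chord on SU(3): 2<(Im W_P)^2> + u <= 1` among torus expectations**: for lattice `SU(3)` Yang–Mills on
`(ℤ/L)^d` (every real `β`, every `d`, every `L ≥ 1`) and a CLOSED word `X` at `x`, in the variables of
`SU3KinematicalRows` (`w(C) = ⟨wordLoop⟩_β`, `d(A, B) = Re E[tr hol A · tr hol B]/9`, `X⁻¹ = reverse X`):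
`d(X⁻¹, X) − d(X, X) + w(X) ≤ 1` (`= 2 E[(Im W_X)²] + E[Re W_X]`, `W = tr/3`). [folklore] -/
theorem su3_deltoid_chord_row [NeZero L] (β : ℝ) (x : Site d L) (X : Word d) (hX : Word.endpoint x X = x) :
    (∫ U, (fundamentalRep (Fin 3) (wordHolonomy U x (Word.reverse X))).trace *
          (fundamentalRep (Fin 3) (wordHolonomy U x X)).trace
        ∂(wilsonMeasure (d := d) (L := L) (fundamentalRep (Fin 3)) β)).re / 9 -
      (∫ U, (fundamentalRep (Fin 3) (wordHolonomy U x X)).trace *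
          (fundamentalRep (Fin 3) (wordHolonomy U x X)).trace
        ∂(wilsonMeasure (d := d) (L := L) (fundamentalRep (Fin 3)) β)).re / 9 +
      wilsonExpectation (d := d) (L := L) (fundamentalRep (Fin 3)) β (wordLoop (fundamentalRep (Fin 3)) x X) ≤ 1 := by
  haveI := isProbabilityMeasure_wilsonMeasure (d := d) (L := L) (fundamentalRep (Fin 3))
    (continuous_fundamentalRep (Fin 3)) β
  -- `tr hol_x(X⁻¹) = conj tr hol_x(X)` for the closed word `X` (`hol(X⁻¹) = hol(X)⁻¹ = hol(X)†`)
  have hrev : ∀ U : GaugeConfig d L (Matrix.specialUnitaryGroup (Fin 3) ℂ),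
      (fundamentalRep (Fin 3) (wordHolonomy U x (Word.reverse X))).trace =
        conj (fundamentalRep (Fin 3) (wordHolonomy U x X)).trace := fun U => by
    have h := wordHolonomy_reverse U x X
    rw [hX] at h
    rw [h, fundamentalRep_apply, fundamentalRep_apply, ← Matrix.star_eq_inv, Matrix.specialUnitaryGroup.coe_star,
      Matrix.star_eq_conjTranspose, Matrix.trace_conjTranspose, Complex.star_def]
  simp_rw [hrev]
  have hc := continuous_trace_wordHolonomy (d := d) (L := L) (fundamentalLatticeRep 3) x X
  have iA : Integrable (fun U : GaugeConfig d L (Matrix.specialUnitaryGroup (Fin 3) ℂ) =>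
      conj (fundamentalRep (Fin 3) (wordHolonomy U x X)).trace * (fundamentalRep (Fin 3) (wordHolonomy U x X)).trace)
      (wilsonMeasure (d := d) (L := L) (fundamentalRep (Fin 3)) β) :=
    integrable_of_continuous (fundamentalLatticeRep 3) β ((Complex.continuous_conj.comp' hc).mul hc)
  have iB : Integrable (fun U : GaugeConfig d L (Matrix.specialUnitaryGroup (Fin 3) ℂ) =>
      (fundamentalRep (Fin 3) (wordHolonomy U x X)).trace * (fundamentalRep (Fin 3) (wordHolonomy U x X)).trace)
      (wilsonMeasure (d := d) (L := L) (fundamentalRep (Fin 3)) β) :=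
    integrable_of_continuous (fundamentalLatticeRep 3) β (hc.mul hc)
  have iW := integrable_wordLoop (d := d) (L := L) (fundamentalRep (Fin 3)) (continuous_fundamentalRep (Fin 3)) β x X
  have hA := integral_re iA
  have hB := integral_re iB
  simp only [RCLike.re_to_complex] at hA hB
  -- integrability of the real integrands, stated with `Complex.re`
  have iA' : Integrable (fun U : GaugeConfig d L (Matrix.specialUnitaryGroup (Fin 3) ℂ) =>
      (conj (fundamentalRep (Fin 3) (wordHolonomy U x X)).trace *
        (fundamentalRep (Fin 3) (wordHolonomy U x X)).trace).re / 9)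
      (wilsonMeasure (d := d) (L := L) (fundamentalRep (Fin 3)) β) := by
    simpa only [RCLike.re_to_complex] using iA.re.div_const 9
  have iB' : Integrable (fun U : GaugeConfig d L (Matrix.specialUnitaryGroup (Fin 3) ℂ) =>
      ((fundamentalRep (Fin 3) (wordHolonomy U x X)).trace *
        (fundamentalRep (Fin 3) (wordHolonomy U x X)).trace).re / 9)
      (wilsonMeasure (d := d) (L := L) (fundamentalRep (Fin 3)) β) := by
    simpa only [RCLike.re_to_complex] using iB.re.div_const 9
  have iC : Integrable (fun U : GaugeConfig d L (Matrix.specialUnitaryGroup (Fin 3) ℂ) =>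
      (conj (fundamentalRep (Fin 3) (wordHolonomy U x X)).trace *
          (fundamentalRep (Fin 3) (wordHolonomy U x X)).trace).re / 9 -
        ((fundamentalRep (Fin 3) (wordHolonomy U x X)).trace *
          (fundamentalRep (Fin 3) (wordHolonomy U x X)).trace).re / 9)
      (wilsonMeasure (d := d) (L := L) (fundamentalRep (Fin 3)) β) := iA'.sub iB'
  have iD : Integrable (fun U : GaugeConfig d L (Matrix.specialUnitaryGroup (Fin 3) ℂ) =>
      (conj (fundamentalRep (Fin 3) (wordHolonomy U x X)).trace *
          (fundamentalRep (Fin 3) (wordHolonomy U x X)).trace).re / 9 -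
        ((fundamentalRep (Fin 3) (wordHolonomy U x X)).trace *
          (fundamentalRep (Fin 3) (wordHolonomy U x X)).trace).re / 9 +
        wordLoop (fundamentalRep (Fin 3)) x X U)
      (wilsonMeasure (d := d) (L := L) (fundamentalRep (Fin 3)) β) := iC.add iW
  rw [← hA, ← hB]
  unfold wilsonExpectation
  rw [← integral_div, ← integral_div, ← integral_sub iA' iB', ← integral_add iC iW]
  calc _ ≤ ∫ _U, (1 : ℝ) ∂(wilsonMeasure (d := d) (L := L) (fundamentalRep (Fin 3)) β) :=
        integral_mono iD (integrable_const _) fun U => su3_deltoid_chord_wordHolonomy U x X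
    _ = 1 := by rw [integral_const, probReal_univ, one_smul]

end Rows

end Summit.QuantumFields.GaugeBoot

end
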